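import Summits.AtomisticToContinuum.Crystallization.Theorems.PhononSlackCertificatesPeriodicGivenLayeredExtraction2

/-!
# `stub_uniformSpacingSelection` (crux `GapTwelveToBarlow`, stmt-AtomisticToContinuum-15807), bridge side, I:
# hull membership from approximating layered windows (extraction WITH MEMORY, variable spacing)

First formal piece of the hull ⇒ a.e. bridge `hullBadLayers_to_ae` (see
`uniformSpacingSelection-REPORT.md`): the part of `LayeredHull.stub_extraction` (stmt-11779) that
happens AFTER the cluster point has been chosen, stated so that the caller keeps the approximating data
(needed to transport bad layers to the limit) and may vary the in-layer spacing `a` (the relaxed-matched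
templates of the crux each carry their own `a ∈ [47/50, 1]`).

`hull_of_approximants` (anchor `stub_hullOfApproximants`): let `(A₀, a₀, s₀, z₀)` be layered data
(`a₀ ∈ [47/50, 1]`, increments of `z₀` in the box, `z₀ 0 ∈ [−17a₀/20, 0]`).  If for every `M`, `ρ > 0`,
`R`, `ε > 0`, frequently in `N`, some translate of `x N` is two-way `ε`-matched on `‖·‖ ≤ R` with the
layered set of data `(A, a, s, z)` that are `ρ`-close to `(A₀, a₀, s₀, z₀)` (`|a − a₀| ≤ ρ`, `s = s₀` and
`|z − z₀| ≤ ρ` on `|m| ≤ M`, `‖A v − A₀ v‖ ≤ ρ ‖v‖`), then the layered set of `(A₀, a₀, s₀, z₀)` is in the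
hull of `x`.  Ingredients: `LayeredHull.ext_close_points` (fixed `a`) and `LayeredHull.ext_match_perturb`,
`ext_match_mono` (landed, Extraction1–2), plus the new scaling step `sel_scale_points`: the in-layer
vectors are linear in `a` (`sel_inplane_eq`) and the in-plane part of a pre-image is shorter than the
pre-image (`sel_norm_inplane_le`), so changing `a` to `a'` moves the points of `‖·‖ ≤ R` by at most
`|a − a'| R / a`.
-/

noncomputable section

namespace Summit.AtomisticToContinuum.Crystallization.Theorems.SquareWellLayerCakeGapTwelveToBarlow

open scoped BigOperators
open Filter Topology Literature.MathematicalPhysics.StatisticalMechanics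
open Summit.AtomisticToContinuum.Crystallization.Theorems.LayeredHull

/-! ## Scaling the in-layer spacing -/

/-- `u(a) = a · u(1)`. [folklore] -/
theorem sel_triangularVec₁_smul (a : ℝ) :
    (triangularVec₁ a : EuclideanSpace ℝ (Fin 3)) = a • triangularVec₁ 1 := by
  ext i; fin_cases i <;> simp [triangularVec₁]

/-- `v(a) = a · v(1)`. [folklore] -/
theorem sel_triangularVec₂_smul (a : ℝ) :
    (triangularVec₂ a : EuclideanSpace ℝ (Fin 3)) = a • triangularVec₂ 1 := by
  ext i; fin_cases i <;> simp [triangularVec₂] <;> ring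

/-- `w(a) = a · w(1)`. [folklore] -/
theorem sel_barlowOffset_smul (a : ℝ) :
    (barlowOffset a : EuclideanSpace ℝ (Fin 3)) = a • barlowOffset 1 := by
  ext i; fin_cases i <;> simp [barlowOffset] <;> ring

/-- The in-plane part of a layered pre-image is linear in the spacing `a`. [folklore] -/
theorem sel_inplane_eq (a : ℝ) (i j : ℤ) (L : ℝ) :
    ((i : ℝ) • triangularVec₁ a) + ((j : ℝ) • triangularVec₂ a) + (L • barlowOffset a) =
      a • (((i : ℝ) • triangularVec₁ 1) + ((j : ℝ) • triangularVec₂ 1) + (L • barlowOffset 1) :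
        EuclideanSpace ℝ (Fin 3)) := by
  rw [sel_triangularVec₁_smul a, sel_triangularVec₂_smul a, sel_barlowOffset_smul a]
  module

/-- The in-plane part of a layered pre-image is not longer than the pre-image (the in-plane vectors
have vanishing third coordinate, the normal has vanishing first two). [folklore] -/
theorem sel_norm_inplane_le (a : ℝ) (i j : ℤ) (L h : ℝ) :
    ‖((i : ℝ) • triangularVec₁ a) + ((j : ℝ) • triangularVec₂ a) + (L • barlowOffset a)‖ ≤
      ‖((i : ℝ) • triangularVec₁ a) + ((j : ℝ) • triangularVec₂ a) + (L • barlowOffset a) +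
        (h • layerNormal 1)‖ := by
  rw [EuclideanSpace.norm_eq, EuclideanSpace.norm_eq, Fin.sum_univ_three, Fin.sum_univ_three]
  apply Real.sqrt_le_sqrt
  simp only [PiLp.add_apply, PiLp.smul_apply, smul_eq_mul, Real.norm_eq_abs, sq_abs]
  simp [triangularVec₁, triangularVec₂, barlowOffset, layerNormal]
  positivity

/-- **Scaling step.** Changing the spacing `a` to `a'` (same `A, s, z`) moves every layered point of
`‖·‖ ≤ R` by at most `|a − a'| R / a`. [folklore] -/
theorem sel_scale_points (A : EuclideanSpace ℝ (Fin 3) →ₗᵢ[ℝ] EuclideanSpace ℝ (Fin 3)) {a : ℝ}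
    (ha : 0 < a) (a' : ℝ) (s : ℤ → ℤ) (z : ℤ → ℝ) (R : ℝ) :
    ∀ p ∈ {p : EuclideanSpace ℝ (Fin 3) | ∃ m i j : ℤ, p = A (((i : ℝ) • triangularVec₁ a) +
        ((j : ℝ) • triangularVec₂ a) + ((haggLabel s m : ℝ) • barlowOffset a) + (z m • layerNormal 1))},
      ‖p‖ ≤ R → ∃ p' ∈ {p : EuclideanSpace ℝ (Fin 3) | ∃ m i j : ℤ, p = A (((i : ℝ) • triangularVec₁ a') +
        ((j : ℝ) • triangularVec₂ a') + ((haggLabel s m : ℝ) • barlowOffset a') + (z m • layerNormal 1))},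
      dist p p' ≤ |a - a'| / a * R := by
  rintro p ⟨m, i, j, rfl⟩ hp
  refine ⟨A (((i : ℝ) • triangularVec₁ a') + ((j : ℝ) • triangularVec₂ a') +
    ((haggLabel s m : ℝ) • barlowOffset a') + (z m • layerNormal 1)), ⟨m, i, j, rfl⟩, ?_⟩
  have hQn := sel_norm_inplane_le a i j (haggLabel s m : ℝ) (z m)
  rw [dist_eq_norm, ← map_sub, A.norm_map]
  rw [A.norm_map] at hp
  rw [sel_inplane_eq a i j, sel_inplane_eq a' i j] at *
  set Q : EuclideanSpace ℝ (Fin 3) := ((i : ℝ) • triangularVec₁ 1) + ((j : ℝ) • triangularVec₂ 1) +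
    ((haggLabel s m : ℝ) • barlowOffset 1) with hQ
  have hdiff : a • Q + z m • layerNormal 1 - (a' • Q + z m • layerNormal 1) = (a - a') • Q := by
    rw [sub_smul]; abel
  rw [hdiff, norm_smul, Real.norm_eq_abs]
  rw [norm_smul, Real.norm_eq_abs, abs_of_pos ha] at hQn
  have hQR : ‖Q‖ ≤ R / a := by
    rw [le_div_iff₀ ha]
    linarith
  calc |a - a'| * ‖Q‖ ≤ |a - a'| * (R / a) := mul_le_mul_of_nonneg_left hQR (abs_nonneg _)
    _ = |a - a'| / a * R := by ring

/-! ## Hull membership from approximants -/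

/-- **Hull membership from approximating windows (extraction with memory, variable spacing).**  If the
layered data `(A₀, a₀, s₀, z₀)` (`a₀ ∈ [47/50, 1]`, increments in the box, `z₀ 0 ∈ [−17a₀/20, 0]`) are
approximated, for every `M, ρ, R, ε`, frequently in `N`, by data `(A, a, s, z)` `ρ`-close to them on
`|m| ≤ M` whose layered set is two-way `ε`-matched by a translate of `x N` on `‖·‖ ≤ R`, then the layered
set of `(A₀, a₀, s₀, z₀)` is two-way matched by translates of `x N` at every scale, frequently in `N`
(it is in the hull of `x`). [folklore] -/
theorem hull_of_approximants (x : (N : ℕ) → (Fin N → EuclideanSpace ℝ (Fin 3)))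
    (A₀ : EuclideanSpace ℝ (Fin 3) →ₗᵢ[ℝ] EuclideanSpace ℝ (Fin 3)) (a₀ : ℝ) (ha₀ : 47 / 50 ≤ a₀)
    (ha₀1 : a₀ ≤ 1) (s₀ : ℤ → ℤ) (z₀ : ℤ → ℝ)
    (hz₀ : ∀ m : ℤ, 39 / 50 * a₀ ≤ z₀ (m + 1) - z₀ m ∧ z₀ (m + 1) - z₀ m ≤ 17 / 20 * a₀)
    (hz₀0 : -(17 / 20 * a₀) ≤ z₀ 0 ∧ z₀ 0 ≤ 0)
    (happrox : ∀ (M : ℕ) (ρ : ℝ), 0 < ρ → ∀ R ε : ℝ, 0 < ε → ∃ᶠ N in atTop,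
      ∃ (t : EuclideanSpace ℝ (Fin 3)) (A : EuclideanSpace ℝ (Fin 3) →ₗᵢ[ℝ] EuclideanSpace ℝ (Fin 3))
        (a : ℝ) (s : ℤ → ℤ) (z : ℤ → ℝ),
        47 / 50 ≤ a ∧ a ≤ 1 ∧ |a - a₀| ≤ ρ ∧
        (∀ m : ℤ, 39 / 50 * a ≤ z (m + 1) - z m ∧ z (m + 1) - z m ≤ 17 / 20 * a) ∧
        (-(17 / 20 * a) ≤ z 0 ∧ z 0 ≤ 0) ∧
        (∀ m : ℤ, |m| ≤ M → s m = s₀ m) ∧ (∀ m : ℤ, |m| ≤ M → |z m - z₀ m| ≤ ρ) ∧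
        (∀ v : EuclideanSpace ℝ (Fin 3), ‖A v - A₀ v‖ ≤ ρ * ‖v‖) ∧
        let S : Set (EuclideanSpace ℝ (Fin 3)) := {p | ∃ m i j : ℤ, p = A (((i : ℝ) • triangularVec₁ a) +
          ((j : ℝ) • triangularVec₂ a) + ((haggLabel s m : ℝ) • barlowOffset a) + (z m • layerNormal 1))};
        (∀ p ∈ S, ‖p‖ ≤ R → ∃ i : Fin N, dist (x N i + t) p ≤ ε) ∧
        (∀ i : Fin N, ‖x N i + t‖ ≤ R → ∃ p ∈ S, dist (x N i + t) p ≤ ε)) :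
    let S₀ : Set (EuclideanSpace ℝ (Fin 3)) := {p | ∃ m i j : ℤ, p = A₀ (((i : ℝ) • triangularVec₁ a₀) +
        ((j : ℝ) • triangularVec₂ a₀) + ((haggLabel s₀ m : ℝ) • barlowOffset a₀) + (z₀ m • layerNormal 1))};
      ∀ R ε : ℝ, 0 < ε → ∃ᶠ N in atTop, ∃ t : EuclideanSpace ℝ (Fin 3),
        (∀ p ∈ S₀, ‖p‖ ≤ R → ∃ i : Fin N, dist (x N i + t) p ≤ ε) ∧
        (∀ i : Fin N, ‖x N i + t‖ ≤ R → ∃ p ∈ S₀, dist (x N i + t) p ≤ ε) := by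
  intro S₀ R ε hε
  have ha₀0 : 0 < a₀ := by linarith
  -- parameters for the target scale `(R, ε)`
  obtain ⟨η, hη0, hηε, hη1⟩ : ∃ η : ℝ, 0 < η ∧ η ≤ ε ∧ η ≤ 1 :=
    ⟨min ε 1, lt_min hε one_pos, min_le_left _ _, min_le_right _ _⟩
  obtain ⟨R', hR'0, hRR'⟩ : ∃ R' : ℝ, 0 ≤ R' ∧ R ≤ R' := ⟨max R 0, le_max_right _ _, le_max_left _ _⟩
  obtain ⟨M, hM⟩ : ∃ M : ℕ, R' + 2 ≤ 39 / 50 * (47 / 50) * M := by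
    obtain ⟨M, hM⟩ := exists_nat_ge ((R' + 2) / (39 / 50 * (47 / 50)))
    exact ⟨M, by rwa [div_le_iff₀' (by positivity)] at hM⟩
  have hR2 : (0 : ℝ) < R' + 2 := by linarith
  set ρ : ℝ := η / (16 * (R' + 2)) with hρ
  have hρ0 : 0 < ρ := by positivity
  -- the closeness budgets
  have hρ1 : ρ ≤ η / 2 / 4 := by
    rw [hρ, div_div]
    exact div_le_div_of_nonneg_left hη0.le (by norm_num) (by linarith)
  have hρ2 : ∀ v : EuclideanSpace ℝ (Fin 3), ‖v‖ ≤ R' + 1 → ρ * ‖v‖ ≤ η / 2 / 4 := by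
    intro v hv
    calc ρ * ‖v‖ ≤ ρ * (R' + 1) := mul_le_mul_of_nonneg_left hv hρ0.le
      _ ≤ η / 2 / 4 := by
          rw [hρ, div_mul_eq_mul_div, div_le_iff₀ (by positivity)]
          nlinarith
  have hρ3 : ρ / (47 / 50) * (R' + 2) ≤ η / 4 := by
    rw [hρ, show η / (16 * (R' + 2)) / (47 / 50) * (R' + 2) = η * (50 / 47) / 16 by
      field_simp]
    linarith
  -- an approximating window at `(M, ρ, R' + 1, η / 2)`
  refine (happrox M ρ hρ0 (R' + 1) (η / 2) (by positivity)).mono fun N hN => ?_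
  obtain ⟨t, A, a, s, z, ha, ha1, haa, hz, hz0, hss, hzz, hAA, hmatch⟩ := hN
  dsimp only at hmatch
  refine ⟨t, ?_⟩
  have ha0 : 0 < a := by linarith
  have hMa : R' + 2 ≤ 39 / 50 * a * M := hM.trans (by gcongr)
  have hMa₀ : R' + 2 ≤ 39 / 50 * a₀ * M := hM.trans (by gcongr)
  have haa' : |a - a₀| / a ≤ ρ / (47 / 50) := div_le_div₀ hρ0.le haa (by norm_num) ha
  have haa'' : |a₀ - a| / a₀ ≤ ρ / (47 / 50) := by
    rw [abs_sub_comm]; exact div_le_div₀ hρ0.le haa (by norm_num) ha₀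
  -- transfer the match from `S` to `S₀` on `‖·‖ ≤ R'`, then shrink to `(R, ε)`
  refine ext_match_mono (x N) t S₀ hRR' hηε (ext_match_perturb (x N) t
    {p | ∃ m i j : ℤ, p = A (((i : ℝ) • triangularVec₁ a) + ((j : ℝ) • triangularVec₂ a) +
      ((haggLabel s m : ℝ) • barlowOffset a) + (z m • layerNormal 1))} S₀ hη1 ?_ ?_ hmatch)
  · -- points of `S` near `S₀`: `(A, a, s, z) → (A₀, a, s₀, z₀)` at spacing `a`, then scale `a → a₀`
    intro p hp hpR
    obtain ⟨p₁, hp₁, hd₁⟩ := ext_close_points (R := R') (η := η / 2) ha0 ha1 A A₀ s s₀ z z₀ hz hz0 hMa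
      hss (fun m hm => (hzz m hm).trans hρ1) (fun v hv => (hAA v).trans (hρ2 v hv)) p hp hpR
    have hp₁R : ‖p₁‖ ≤ R' + 2 := by
      have h1 := dist_triangle p₁ p (0 : EuclideanSpace ℝ (Fin 3))
      rw [dist_zero_right, dist_zero_right, dist_comm] at h1
      linarith
    obtain ⟨p', hp', hd'⟩ := sel_scale_points A₀ ha0 a₀ s₀ z₀ (R' + 2) p₁ hp₁ hp₁R
    refine ⟨p', hp', ?_⟩
    calc dist p p' ≤ dist p p₁ + dist p₁ p' := dist_triangle _ _ _
      _ ≤ η / 2 / 2 + |a - a₀| / a * (R' + 2) := add_le_add hd₁ hd'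
      _ ≤ η / 2 / 2 + ρ / (47 / 50) * (R' + 2) := by gcongr
      _ ≤ η / 2 := by linarith
  · -- points of `S₀` near `S`: `(A₀, a₀, s₀, z₀) → (A, a₀, s, z)` at spacing `a₀`, then scale `a₀ → a`
    intro p' hp' hp'R
    obtain ⟨p₁, hp₁, hd₁⟩ := ext_close_points (R := R') (η := η / 2) ha₀0 ha₀1 A₀ A s₀ s z₀ z hz₀ hz₀0
      hMa₀ (fun m hm => (hss m hm).symm)
      (fun m hm => by rw [abs_sub_comm]; exact (hzz m hm).trans hρ1)
      (fun v hv => by rw [norm_sub_rev]; exact (hAA v).trans (hρ2 v hv)) p' hp' hp'R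
    have hp₁R : ‖p₁‖ ≤ R' + 2 := by
      have h1 := dist_triangle p₁ p' (0 : EuclideanSpace ℝ (Fin 3))
      rw [dist_zero_right, dist_zero_right, dist_comm] at h1
      linarith
    obtain ⟨p, hp, hd⟩ := sel_scale_points A ha₀0 a s z (R' + 2) p₁ hp₁ hp₁R
    refine ⟨p, hp, ?_⟩
    calc dist p' p ≤ dist p' p₁ + dist p₁ p := dist_triangle _ _ _
      _ ≤ η / 2 / 2 + |a₀ - a| / a₀ * (R' + 2) := add_le_add hd₁ hd
      _ ≤ η / 2 / 2 + ρ / (47 / 50) * (R' + 2) := by gcongr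
      _ ≤ η / 2 := by linarith

/-- **Anchor (registered sub-goal form of `hull_of_approximants`, closed statement).**  Layered data
approximated at every precision by layered windows of `x` (frequently in `N`, variable spacing, same
vocabulary as `LayeredHull.stub_extraction`) define a layered set in the hull of `x`. [folklore] -/
theorem stub_hullOfApproximants :
    ∀ (x : (N : ℕ) → (Fin N → EuclideanSpace ℝ (Fin 3)))
      (A₀ : EuclideanSpace ℝ (Fin 3) →ₗᵢ[ℝ] EuclideanSpace ℝ (Fin 3)) (a₀ : ℝ), 47 / 50 ≤ a₀ → a₀ ≤ 1 →
      ∀ (s₀ : ℤ → ℤ) (z₀ : ℤ → ℝ),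
      (∀ m : ℤ, 39 / 50 * a₀ ≤ z₀ (m + 1) - z₀ m ∧ z₀ (m + 1) - z₀ m ≤ 17 / 20 * a₀) →
      (-(17 / 20 * a₀) ≤ z₀ 0 ∧ z₀ 0 ≤ 0) →
      (∀ (M : ℕ) (ρ : ℝ), 0 < ρ → ∀ R ε : ℝ, 0 < ε → ∃ᶠ N in atTop,
        ∃ (t : EuclideanSpace ℝ (Fin 3)) (A : EuclideanSpace ℝ (Fin 3) →ₗᵢ[ℝ] EuclideanSpace ℝ (Fin 3))
          (a : ℝ) (s : ℤ → ℤ) (z : ℤ → ℝ),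
          47 / 50 ≤ a ∧ a ≤ 1 ∧ |a - a₀| ≤ ρ ∧
          (∀ m : ℤ, 39 / 50 * a ≤ z (m + 1) - z m ∧ z (m + 1) - z m ≤ 17 / 20 * a) ∧
          (-(17 / 20 * a) ≤ z 0 ∧ z 0 ≤ 0) ∧
          (∀ m : ℤ, |m| ≤ M → s m = s₀ m) ∧ (∀ m : ℤ, |m| ≤ M → |z m - z₀ m| ≤ ρ) ∧
          (∀ v : EuclideanSpace ℝ (Fin 3), ‖A v - A₀ v‖ ≤ ρ * ‖v‖) ∧
          let S : Set (EuclideanSpace ℝ (Fin 3)) := {p | ∃ m i j : ℤ, p = A (((i : ℝ) • triangularVec₁ a) +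
            ((j : ℝ) • triangularVec₂ a) + ((haggLabel s m : ℝ) • barlowOffset a) + (z m • layerNormal 1))};
          (∀ p ∈ S, ‖p‖ ≤ R → ∃ i : Fin N, dist (x N i + t) p ≤ ε) ∧
          (∀ i : Fin N, ‖x N i + t‖ ≤ R → ∃ p ∈ S, dist (x N i + t) p ≤ ε)) →
      let S₀ : Set (EuclideanSpace ℝ (Fin 3)) := {p | ∃ m i j : ℤ, p = A₀ (((i : ℝ) • triangularVec₁ a₀) +
          ((j : ℝ) • triangularVec₂ a₀) + ((haggLabel s₀ m : ℝ) • barlowOffset a₀) + (z₀ m • layerNormal 1))};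
        ∀ R ε : ℝ, 0 < ε → ∃ᶠ N in atTop, ∃ t : EuclideanSpace ℝ (Fin 3),
          (∀ p ∈ S₀, ‖p‖ ≤ R → ∃ i : Fin N, dist (x N i + t) p ≤ ε) ∧
          (∀ i : Fin N, ‖x N i + t‖ ≤ R → ∃ p ∈ S₀, dist (x N i + t) p ≤ ε) :=
  fun x A₀ a₀ ha₀ ha₀1 s₀ z₀ hz₀ hz₀0 happrox =>
    hull_of_approximants x A₀ a₀ ha₀ ha₀1 s₀ z₀ hz₀ hz₀0 happrox

end Summit.AtomisticToContinuum.Crystallization.Theorems.SquareWellLayerCakeGapTwelveToBarlow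

end
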